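import Summits.ResolutionOfSingularities.ResolutionOfSingularities.Theorems.WeightedInvariantIota3JFlat
import HarnessLib

/-!
# `J₃` OF RECORD, v1.3 SHAPE: the ε-SWITCHED core `jFlatCoreE` and the PARAMETRIC cylinder `jFlatOver ι₀` (door `HypersurfaceCentreConstruction`,
# stmt-ResolutionOfSingularities-19897; KEY `stub_localWeightedDropEFT4S`; P3 rung `stub_keyRung_dimLEThree`, skeleton v3.7 / ladder `PRung d`
# p522114; ORDER (o37) sequel per res-L1-w43-plan-1 IOTA3-DESIGN v1.3 §8.3 (RULING gen 11 #2); typer res-type-061)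

Topic: `Summits/ResolutionOfSingularities/ResolutionOfSingularities/Theorems`. DEFINITIONS posited by the route `WeightedInvariant` for the door
item `HypersurfaceCentreConstruction` (`--supports stmt-ResolutionOfSingularities-19897 --as helper`) — objects OF THE LINE, not cited statements —
continuing `…Iota3JFlat` (p530288, the v1.2 instance `jFlat = jCylinder iotaOrdEps jFlatCore`, which stays):

* **`Iota3.jFlatCoreE R f m := if ringKrullDim R ≤ 2 ∨ iotaEps R f = 1 then jContact R f m else jSigmaPt R f m`** — v1.3's core: the
  DIMENSION switch of `jFlatCore` plus res-type-078's ε-SWITCH for the point branch («the switch is ε», P3c-H′): at a CROSSING point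
  (`ε = 1`) the integer one-slope rule `jContact` (res-type-092, p514802), at an ε = 0 point-centre position of dimension 3 (isolated or tie)
  the exact σ-flag rule `jSigmaPt` (p530288).
* **`Iota3.jFlatOver ι₀ := ContactCylinder.jCylinder ι₀ jFlatCoreE`** — the core READ AT THE GENERIC POINT of the top `ι₀`-stratum, PARAMETRIC
  in the stratifier `ι₀` (v1.2: `ι₀ = iotaOrdEps`; v1.3: `ι₀ = iotaOrdEpsTau` of res-type-013's (o40), giving `jFlatT := jFlatOver iotaOrdEpsTau`
  in a sequel once that letter lands); `Iota3.jFlatE := jFlatOver iotaOrdEps`.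
* TRANSPORT: `jFlatCoreE_isoInvariant` / `jFlatCoreE_unitInvariant` (Krull dimension and `ε` are iso- and unit-invariant: Mathlib `RingEquiv.ringKrullDim`,
  013's `iotaEps_isoInvariant` / `iotaEps_unitInvariant` p527087) and, by res-type-061's `jCylinder_isoInvariant` / `jCylinder_unitInvariant`
  (p527090), **`jFlatOver_isoInvariant (h₀ : IotaIsoInvariant ι₀)`**, **`jFlatOver_unitInvariant (h₀ : IotaUnitInvariant ι₀)`** — the conjuncts
  (c5) / (c12-J) of `PRung 3 p ι (jFlatOver ι₀)` for every iso- and unit-invariant stratifier.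
* REGIMES (IOTA3-DESIGN v1.3 §8.4 table): curve (`top ι₀-stratum = V(P)`, `dim R_P ≤ 2`) ⇒ the CYLINDER over `jContact (R_P)`
  (`jFlatOver_eq_cylinderAt_jContact`); point-centre (`topStratumPrime ι₀ = 𝔪`) & crossing (`ε = 1`) ⇒ `jContact` (`jFlatOver_eq_jContact_of_eps_eq_one`);
  point-centre & `ε ≠ 1` & dimension 3 ⇒ `jSigmaPt` (`jFlatOver_eq_jSigmaPt`); point-centre & dimension ≤ 2 ⇒ `jContact` (`jFlatOver_eq_jContact_of_dim_le_two`).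

[OURS · candidates · objects of a conjecture-grade rung of OUR key; nothing here asserts anything about Hironaka's problem; NOT a statement of the
manuscript under review (Hironaka 2017, [claim: Hironaka2017, status: under-review]); AI typing, weaker than expert review.]
-/

noncomputable section

open IsLocalRing Literature.AlgebraicGeometry.Resolution
open Summit.ResolutionOfSingularities.ResolutionOfSingularities.Theorems

set_option linter.dupNamespace false -- mandated namespace of this single-conjunct summit

namespace Summit.ResolutionOfSingularities.ResolutionOfSingularities.Cruxes.HypersurfaceCentreConstruction.LocalEngine

namespace Iota3

/-! ## Definitions -/

open Classical in
/-- [OURS · (o37) v1.3 · candidate] **The ε-switched core `jFlatCoreE`**: `jContact R f m` when `ringKrullDim R ≤ 2` OR the position is a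
CROSSING point (`iotaEps R f = 1`: the equimultiple locus is not a permissible centre), `jSigmaPt R f m` otherwise (ε = 0 point-centre positions
of dimension ≥ 3: exact σ-flag weights).  IOTA3-DESIGN v1.3 §8.3. -/
def jFlatCoreE (R : Type) [CommRing R] (f : R) (m : ℕ) : Ideal R :=
  if ringKrullDim R ≤ 2 ∨ iotaEps R f = 1 then jContact R f m else jSigmaPt R f m

/-- [OURS · (o37) v1.3 · candidate] **The parametric centre rule `jFlatOver ι₀`**: the ε-switched core read at the generic point of the top
`ι₀`-stratum (res-type-005's `ContactCylinder.jCylinder`, p524206).  `jFlatT := jFlatOver iotaOrdEpsTau` is v1.3's `J₃ᵗ` (sequel, after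
res-type-013's τ letter). -/
def jFlatOver (ι₀ : (R : Type) → [CommRing R] → R → Ordinal.{0}) : (R : Type) → [CommRing R] → R → ℕ → Ideal R :=
  ContactCylinder.jCylinder ι₀ jFlatCoreE

/-- [OURS · (o37) v1.3 · candidate] The ε-switched rule over the v1.2 stratifier `(ν; ε)`: `jFlatE := jFlatOver iotaOrdEps`. -/
def jFlatE : (R : Type) → [CommRing R] → R → ℕ → Ideal R :=
  jFlatOver iotaOrdEps

/-! ## Unfolding lemmas -/

/-- The `jContact` branch of the core (dimension ≤ 2 or crossing). [folklore] -/
theorem jFlatCoreE_of_pos (R : Type) [CommRing R] {f : R} (h : ringKrullDim R ≤ 2 ∨ iotaEps R f = 1) (m : ℕ) :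
    jFlatCoreE R f m = jContact R f m := by
  unfold jFlatCoreE
  rw [if_pos h]

/-- The `jSigmaPt` branch of the core (dimension ≥ 3 and ε ≠ 1). [folklore] -/
theorem jFlatCoreE_of_neg (R : Type) [CommRing R] {f : R} (h : ¬ (ringKrullDim R ≤ 2 ∨ iotaEps R f = 1)) (m : ℕ) :
    jFlatCoreE R f m = jSigmaPt R f m := by
  unfold jFlatCoreE
  rw [if_neg h]

/-- The `jSigmaPt` branch, hypotheses split. [folklore] -/
theorem jFlatCoreE_of_not_dim_le_two_of_eps_ne_one (R : Type) [CommRing R] {f : R} (hdim : ¬ ringKrullDim R ≤ 2) (hε : iotaEps R f ≠ 1)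
    (m : ℕ) : jFlatCoreE R f m = jSigmaPt R f m :=
  jFlatCoreE_of_neg R (fun h => h.elim hdim hε) m

/-- `jFlatOver` unfolded. [folklore] -/
theorem jFlatOver_def (ι₀ : (R : Type) → [CommRing R] → R → Ordinal.{0}) (R : Type) [CommRing R] (f : R) (m : ℕ) :
    jFlatOver ι₀ R f m = ContactCylinder.jCylinder ι₀ jFlatCoreE R f m := rfl

/-- `jFlatE` unfolded. [folklore] -/
theorem jFlatE_def (R : Type) [CommRing R] (f : R) (m : ℕ) : jFlatE R f m = jFlatOver iotaOrdEps R f m := rfl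

/-! ## Transport -/

/-- **`jFlatCoreE` is iso-invariant**: the switch condition is iso-invariant (`RingEquiv.ringKrullDim`, `iotaEps_isoInvariant`) and so are both
branches (`jContact_isoInvariant`, `jSigmaPt_isoInvariant`). [OURS · (o37) v1.3] -/
theorem jFlatCoreE_isoInvariant : JIsoInvariant jFlatCoreE := by
  intro R T _ _ e g m
  have hcond : (ringKrullDim T ≤ 2 ∨ iotaEps T (e g) = 1) ↔ (ringKrullDim R ≤ 2 ∨ iotaEps R g = 1) := by
    rw [← RingEquiv.ringKrullDim e, iotaEps_isoInvariant R T e g]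
  by_cases h : ringKrullDim R ≤ 2 ∨ iotaEps R g = 1
  · rw [jFlatCoreE_of_pos R h, jFlatCoreE_of_pos T (hcond.mpr h), jContact_isoInvariant R T e g m]
  · rw [jFlatCoreE_of_neg R h, jFlatCoreE_of_neg T (fun h' => h (hcond.mp h')), jSigmaPt_isoInvariant R T e g m]

/-- **`jFlatCoreE` is unit-invariant** (`iotaEps_unitInvariant`, `jContact_unitInvariant`, `jSigmaPt_unitInvariant`). [OURS · (o37) v1.3] -/
theorem jFlatCoreE_unitInvariant : JUnitInvariant jFlatCoreE := by
  intro R _ v g m hv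
  have hcond : (ringKrullDim R ≤ 2 ∨ iotaEps R (v * g) = 1) ↔ (ringKrullDim R ≤ 2 ∨ iotaEps R g = 1) := by
    rw [iotaEps_unitInvariant R v g hv]
  by_cases h : ringKrullDim R ≤ 2 ∨ iotaEps R g = 1
  · rw [jFlatCoreE_of_pos R (hcond.mpr h), jFlatCoreE_of_pos R h, jContact_unitInvariant R v g m hv]
  · rw [jFlatCoreE_of_neg R (fun h' => h (hcond.mp h')), jFlatCoreE_of_neg R h, jSigmaPt_unitInvariant R v g m hv]

/-- **(c5) for every iso-invariant stratifier: `JIsoInvariant (jFlatOver ι₀)`** (res-type-061's `jCylinder_isoInvariant`, p527090).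
[OURS · (o37) v1.3] -/
theorem jFlatOver_isoInvariant {ι₀ : (R : Type) → [CommRing R] → R → Ordinal.{0}} (h₀ : IotaIsoInvariant ι₀) :
    JIsoInvariant (jFlatOver ι₀) :=
  ContactCylinder.jCylinder_isoInvariant ι₀ jFlatCoreE h₀ jFlatCoreE_isoInvariant

/-- **(c12-J) for every unit-invariant stratifier: `JUnitInvariant (jFlatOver ι₀)`** (`jCylinder_unitInvariant`). [OURS · (o37) v1.3] -/
theorem jFlatOver_unitInvariant {ι₀ : (R : Type) → [CommRing R] → R → Ordinal.{0}} (h₀ : IotaUnitInvariant ι₀) :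
    JUnitInvariant (jFlatOver ι₀) :=
  ContactCylinder.jCylinder_unitInvariant ι₀ jFlatCoreE h₀ jFlatCoreE_unitInvariant

/-- (c5) for `jFlatE`. [OURS · (o37) v1.3] -/
theorem jFlatE_isoInvariant : JIsoInvariant jFlatE := jFlatOver_isoInvariant iotaOrdEps_isoInvariant

/-- (c12-J) for `jFlatE`. [OURS · (o37) v1.3] -/
theorem jFlatE_unitInvariant : JUnitInvariant jFlatE := jFlatOver_unitInvariant iotaOrdEps_unitInvariant

/-! ## Regimes (IOTA3-DESIGN v1.3 §8.4) -/

section Regimes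

variable (ι₀ : (R : Type) → [CommRing R] → R → Ordinal.{0})

/-- **The value when the top `ι₀`-stratum is `V(P)`**: `jFlatOver ι₀ R f m = (jFlatCoreE (R_P) (f/1) m) ∩ R`. [OURS · (o37) v1.3] -/
theorem jFlatOver_eq_of_topStratum_eq (R : Type) [CommRing R] (f : R) (m : ℕ) {P : Ideal R} [P.IsPrime]
    (hE : ContactCylinder.topStratum ι₀ R f = {𝔮 | P ≤ 𝔮.asIdeal}) :
    jFlatOver ι₀ R f m = (jFlatCoreE (Localization.AtPrime P) (algebraMap R (Localization.AtPrime P) f) m).comap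
      (algebraMap R (Localization.AtPrime P)) :=
  ContactCylinder.jCylinder_eq_of_topStratum_eq ι₀ jFlatCoreE R f m hE

/-- **CURVE regime**: top `ι₀`-stratum `= V(P)` with `dim R_P ≤ 2` ⇒ `jFlatOver ι₀ R f m = cylinderAt jContact R P f m` — the cylinder over the
P2 rule read in the surface germ `R_P` (the ε-switch is silent below dimension 3). [OURS · (o37) v1.3] -/
theorem jFlatOver_eq_cylinderAt_jContact (R : Type) [CommRing R] (f : R) (m : ℕ) {P : Ideal R} [P.IsPrime]
    (hE : ContactCylinder.topStratum ι₀ R f = {𝔮 | P ≤ 𝔮.asIdeal}) (hdim : ringKrullDim (Localization.AtPrime P) ≤ 2) :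
    jFlatOver ι₀ R f m = ContactCylinder.cylinderAt jContact R P f m := by
  rw [jFlatOver_eq_of_topStratum_eq ι₀ R f m hE, jFlatCoreE_of_pos _ (Or.inl hdim), ContactCylinder.cylinderAt_def]

/-- **POINT-CENTRE regime, raw form**: generic prime of the top `ι₀`-stratum `= 𝔪` ⇒ `jFlatOver ι₀ R f m = jFlatCoreE R f m`
(005's `jCylinder_of_topStratumPrime_eq_maximalIdeal` with `jFlatCoreE_isoInvariant`). [OURS · (o37) v1.3] -/
theorem jFlatOver_eq_jFlatCoreE (R : Type) [CommRing R] [IsLocalRing R] (f : R) (m : ℕ)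
    (h : ContactCylinder.topStratumPrime ι₀ R f = maximalIdeal R) : jFlatOver ι₀ R f m = jFlatCoreE R f m :=
  ContactCylinder.jCylinder_of_topStratumPrime_eq_maximalIdeal ι₀ jFlatCoreE_isoInvariant R f m h

/-- **CROSSING regime**: point-centre position with `ε = 1` ⇒ `jFlatOver ι₀ R f m = jContact R f m` (the integer one-slope rule: `x` with weight
`bMax`, transversals weight `1`). [OURS · (o37) v1.3] -/
theorem jFlatOver_eq_jContact_of_eps_eq_one (R : Type) [CommRing R] [IsLocalRing R] (f : R) (m : ℕ)
    (h : ContactCylinder.topStratumPrime ι₀ R f = maximalIdeal R) (hε : iotaEps R f = 1) : jFlatOver ι₀ R f m = jContact R f m := by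
  rw [jFlatOver_eq_jFlatCoreE ι₀ R f m h, jFlatCoreE_of_pos R (Or.inr hε)]

/-- **ISOLATED / TIE regime in dimension 3**: point-centre position with `ε ≠ 1` and `¬ dim R ≤ 2` ⇒ `jFlatOver ι₀ R f m = jSigmaPt R f m` (exact
σ-flag weights). [OURS · (o37) v1.3] -/
theorem jFlatOver_eq_jSigmaPt (R : Type) [CommRing R] [IsLocalRing R] (f : R) (m : ℕ)
    (h : ContactCylinder.topStratumPrime ι₀ R f = maximalIdeal R) (hdim : ¬ ringKrullDim R ≤ 2) (hε : iotaEps R f ≠ 1) :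
    jFlatOver ι₀ R f m = jSigmaPt R f m := by
  rw [jFlatOver_eq_jFlatCoreE ι₀ R f m h, jFlatCoreE_of_not_dim_le_two_of_eps_ne_one R hdim hε]

/-- **LOW-DIMENSION regime**: point-centre position of Krull dimension `≤ 2` ⇒ `jFlatOver ι₀ R f m = jContact R f m` (the P2 rule verbatim).
[OURS · (o37) v1.3] -/
theorem jFlatOver_eq_jContact_of_dim_le_two (R : Type) [CommRing R] [IsLocalRing R] (f : R) (m : ℕ)
    (h : ContactCylinder.topStratumPrime ι₀ R f = maximalIdeal R) (hdim : ringKrullDim R ≤ 2) : jFlatOver ι₀ R f m = jContact R f m := by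
  rw [jFlatOver_eq_jFlatCoreE ι₀ R f m h, jFlatCoreE_of_pos R (Or.inl hdim)]

/-- An attaining flag's filtration lies in `jFlatOver ι₀` at a dimension-3, ε ≠ 1 point-centre position ((adm)-shape, via p530288's
`flagContactFiltration_le_jSigmaPt`). [OURS · (o37) v1.3] -/
theorem flagContactFiltration_le_jFlatOver (R : Type) [CommRing R] [IsLocalRing R] {f : R} (hf0 : f ≠ 0) (hfu : ¬ IsUnit f)
    (h : ContactCylinder.topStratumPrime ι₀ R f = maximalIdeal R) (hdim : ¬ ringKrullDim R ≤ 2) (hε : iotaEps R f ≠ 1)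
    {g₁ g₂ : R} {q r₁ r₂ : ℕ} (hmax : IsSigmaMaximiser f (adicOrder f).toNat g₁ g₂ q r₁ r₂) (hprim : IsPrimitiveTriple q r₁ r₂) (m : ℕ) :
    flagContactFiltration g₁ g₂ q r₁ r₂ m ≤ jFlatOver ι₀ R f m := by
  rw [jFlatOver_eq_jSigmaPt ι₀ R f m h hdim hε]
  exact flagContactFiltration_le_jSigmaPt R hf0 hfu hmax hprim m

end Regimes

end Iota3

end Summit.ResolutionOfSingularities.ResolutionOfSingularities.Cruxes.HypersurfaceCentreConstruction.LocalEngine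

end
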